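import Summits.Ventures.QEC.Thresholds.OptimalPhenomThresholds
import HarnessLib

/-!
# Rate versus the DECODER-FREE (optimal) thresholds: `p₀^{Z,opt} + p₀^{X,opt} ≤ (1 − R)/2` (code capacity) and
# `p₀^{ph,Z,opt} + p₀^{ph,X,opt} ≤ (1 − R)/2` (phenomenological, `q = p`), for every CSS family with `k ≥ 1`

Venture QEC, `Summits/Ventures/QEC/Thresholds/` (LADDER-QEC rung Q5; qec-lit-2 gen 6). HONEST FRAMING. Companion of
`OptimalDecoderThresholds.lean` (`optimal_thresholds_add_le_half`: `a + b ≤ 1/2`) and `OptimalPhenomThresholds.lean`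
(`phenom_optimal_thresholds_add_le_half`): the rate-free `k ≥ 1` ceilings of the OPTIMAL (maximum-likelihood,
rate-by-rate) sector families sharpen linearly in the RATE of the family, exactly as the any-decoder-family forms of
`Literature/…/CSSErasureCapacityConverse.lean` (`capacity_thresholds_add_le_half_sub_rate`) and
`Literature/…/CSSPhenomenologicalConverse.lean` (`phenom_thresholds_add_le_half_sub_rate`). The optimal family's
decoder depends on `p`, so those theorems (stated for ONE `p`-independent decoder family) do not apply verbatim; but
their RATE forms (`capacity_rates_add_le_half_sub_rate`, `phenom_rates_add_le_half_sub_rate`) concern one pair of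
rates at a time, where the optimum IS attained by a decoder family (`CSSCode.exists_zFailure_eq_zOptimalFailure`,
`exists_zPhenomFailureFamily_eq_optimal`), and the threshold forms follow by the usual squeeze between two rates.
For every family of CSS codes `C_i` with `k_i ≥ 1` and `R · n_i ≤ k_i` for all `i`:

* code capacity: below-threshold rates `p` (optimal `Z`) and `p'` (optimal `X`) with `p + p' ≤ 1/2` satisfy
  `p + p' ≤ (1 − R)/2` (`optimal_rates_add_le_half_sub_rate`); one sector alone `p ≤ (1 − R)/2`; certified threshold
  lower bounds `a + b ≤ (1 − R)/2` (`optimal_thresholds_add_le_half_sub_rate`), each alone `≤ (1 − R)/2`;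
  `p_c^{Z,opt} + p_c^{X,opt} ≤ (1 − R)/2`; sector-symmetric families `p_c^{opt} ≤ (1 − R)/4`;
* phenomenological noise at `q = p`, rounds `T_i, T'_i ≥ 1`: the same list for `zOptimalPhenomFailureFamily C T` /
  `xOptimalPhenomFailureFamily C T'` (`phenom_optimal_rates_add_le_half_sub_rate`,
  `phenom_optimal_thresholds_add_le_half_sub_rate`, `p_c^{ph,Z,opt} + p_c^{ph,X,opt} ≤ (1 − R)/2`).

Since every decoder family's accuracy threshold is at most the optimal one (`z_accuracyThreshold_le_optimal`,
`z_phenom_accuracyThreshold_le_optimal`), these are the strongest forms of the `2p`-erasure ceilings in the tree; the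
entropy (hashing) ceilings `h₂(p_c) ≤ 1 − R` per sector of `HashingBoundThresholds.lean` are a different, for `R`
near `1` much stronger, constraint and are not restated. For the rate-`0` census families (toric, planar) nothing new.
Kernel axioms only; no named fact; no `native_decide`; no new definition.

## References

* [BennettDivincenzoSmolin1997] C. H. Bennett, D. P. DiVincenzo, J. A. Smolin, PRL 78 (1997) 3217, p. 3218
  (`Q = max{0, 1 − 2ε}`, «two bits of redundancy per erased qubit are necessary»).
* [DelfosseZemor2013] N. Delfosse, G. Zémor, QIC 13 (2013) 793, §3 (`R ≤ 1 − 2p` for stabilizer codes).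
* [RichardsonUrbanke2008] T. Richardson, R. Urbanke, *Modern Coding Theory*, CUP 2008, Lemma 4.78 (erasure
  decomposition `BSC(p) = BEC(2p)` filled with fair coins).
* [DennisEtAl2002] E. Dennis, A. Kitaev, A. Landahl, J. Preskill, J. Math. Phys. 43 (2002) 4452, §4.3 (optimal
  recovery), §4.6–4.7 (`p_c`; any method gives a lower bound), §5.3 (`p = q`).
* [BravyiSucharaVargo2014] S. Bravyi, M. Suchara, A. Vargo, Phys. Rev. A 90 (2014) 032326, §1–2 (MLD is optimal).
-/

noncomputable section

namespace Summit.Ventures.QEC.Thresholds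

open Filter Topology Finset Matrix
open Literature.InformationTheory.QuantumCodes
open Literature.InformationTheory.QuantumCodes.CSSPhenom

/-- A rate strictly inside two overlapping constraints: if `a, b > 0`, `0 ≤ c < a + b`, some `0 ≤ y ≤ c` has
`y < a` and `c - y < b`. [folklore] -/
private theorem exists_rate_between_opt {a b c : ℝ} (hc : 0 ≤ c) (ha : 0 < a) (hb : 0 < b) (h : c < a + b) :
    ∃ y : ℝ, 0 ≤ y ∧ y ≤ c ∧ y < a ∧ c - y < b := by
  refine ⟨min c (max 0 ((c - b + a) / 2)), le_min hc (le_max_left _ _), min_le_left _ _, ?_, ?_⟩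
  · exact lt_of_le_of_lt (min_le_right _ _) (max_lt ha (by linarith))
  · have : c - b < min c (max 0 ((c - b + a) / 2)) :=
      lt_min (by linarith) (lt_of_lt_of_le (by linarith) (le_max_right _ _))
    linarith

section CSSFamilies

variable {RX RZ Q : ℕ → Type*} [∀ i, Fintype (Q i)] [∀ i, DecidableEq (Q i)] [∀ i, Fintype (RX i)]
  [∀ i, Fintype (RZ i)]

omit [∀ i, DecidableEq (Q i)] [∀ i, Fintype (RZ i)] in
/-- A family with `k ≥ 1` and `R n ≤ k` has `R ≤ 1`. [cite: BravyiEtAl2024, §4, proof of Lemma 1 (k = n − rk H^X − rk H^Z)] -/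
private theorem rate_le_one_opt (C : ∀ i, CSSCode (RX i) (RZ i) (Q i)) (hk : ∀ i, 0 < (C i).k) {R : ℝ}
    (hR : ∀ i, R * Fintype.card (Q i) ≤ (C i).k) : R ≤ 1 := by
  have hn : (0 : ℝ) < Fintype.card (Q 0) := by
    exact_mod_cast lt_of_lt_of_le (hk 0) (C 0).k_le_card
  have h1 : ((C 0).k : ℝ) ≤ Fintype.card (Q 0) := by exact_mod_cast (C 0).k_le_card
  have h2 : R * Fintype.card (Q 0) ≤ 1 * Fintype.card (Q 0) := by linarith [hR 0]
  exact le_of_mul_le_mul_right h2 hn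

/-! ### Code capacity: the optimal sector families -/

/-- **Two below-threshold flip rates cost `2p + 2p'` of rate — optimal decoding.** For a family of CSS codes with
`k ≥ 1` and rate `≥ R`: if the OPTIMAL `Z`-failure is below threshold at `p` and the optimal `X`-failure at `p'`
(`p, p' ≥ 0`, `p + p' ≤ 1/2`), then `p + p' ≤ (1 − R)/2` (at each rate the optimum is a decoder family's failure,
to which `capacity_rates_add_le_half_sub_rate` applies).
[cite: BennettDivincenzoSmolin1997, p. 3218 (Q ≤ 1 − 2ε); RichardsonUrbanke2008, Lemma 4.78; BravyiSucharaVargo2014, §2 (ML decoder attains the optimum)] -/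
theorem optimal_rates_add_le_half_sub_rate (C : ∀ i, CSSCode (RX i) (RZ i) (Q i)) (hk : ∀ i, 0 < (C i).k)
    {R : ℝ} (hR : ∀ i, R * Fintype.card (Q i) ≤ (C i).k) {p p' : ℝ} (hp : 0 ≤ p) (hp' : 0 ≤ p')
    (hpp : p + p' ≤ 1 / 2) (hZ : BelowThreshold (zOptimalFailureFamily C) p)
    (hX : BelowThreshold (xOptimalFailureFamily C) p') : p + p' ≤ (1 - R) / 2 := by
  classical
  have hDZ := fun i => (C i).exists_zFailure_eq_zOptimalFailure p
  have hDX := fun i => (C i).exists_xFailure_eq_xOptimalFailure p'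
  choose DZ _ hDZ' using hDZ
  choose DX _ hDX' using hDX
  refine capacity_rates_add_le_half_sub_rate C hk hR DZ DX hp hp' hpp ?_ ?_
  · unfold BelowThreshold at hZ ⊢
    exact hZ.congr fun i => (hDZ' i).symm
  · unfold BelowThreshold at hX ⊢
    exact hX.congr fun i => (hDX' i).symm

/-- **One sector alone, optimal decoding**: a below-threshold rate `0 ≤ p ≤ 1/2` of the optimal `Z`-family forces
`p ≤ (1 − R)/2`. [cite: BennettDivincenzoSmolin1997, p. 3218 (Q ≤ 1 − 2ε); RichardsonUrbanke2008, Lemma 4.78] -/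
theorem z_optimal_rate_le_half_sub_rate (C : ∀ i, CSSCode (RX i) (RZ i) (Q i)) (hk : ∀ i, 0 < (C i).k)
    {R : ℝ} (hR : ∀ i, R * Fintype.card (Q i) ≤ (C i).k) {p : ℝ} (hp : 0 ≤ p) (hp1 : p ≤ 1 / 2)
    (hZ : BelowThreshold (zOptimalFailureFamily C) p) : p ≤ (1 - R) / 2 := by
  classical
  have hDZ := fun i => (C i).exists_zFailure_eq_zOptimalFailure p
  choose DZ _ hDZ' using hDZ
  refine capacity_rate_le_half_sub_rate C hk hR DZ hp hp1 ?_
  unfold BelowThreshold at hZ ⊢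
  exact hZ.congr fun i => (hDZ' i).symm

/-- The `X`-sector alone, optimal decoding: `p' ≤ (1 − R)/2`. [cite: BennettDivincenzoSmolin1997, p. 3218; RichardsonUrbanke2008, Lemma 4.78] -/
theorem x_optimal_rate_le_half_sub_rate (C : ∀ i, CSSCode (RX i) (RZ i) (Q i)) (hk : ∀ i, 0 < (C i).k)
    {R : ℝ} (hR : ∀ i, R * Fintype.card (Q i) ≤ (C i).k) {p' : ℝ} (hp' : 0 ≤ p') (hp1 : p' ≤ 1 / 2)
    (hX : BelowThreshold (xOptimalFailureFamily C) p') : p' ≤ (1 - R) / 2 := by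
  rw [xOptimalFailureFamily_eq_swap] at hX
  exact z_optimal_rate_le_half_sub_rate (fun i => (C i).swap) (fun i => by rw [CSSCode.k_swap]; exact hk i)
    (fun i => by rw [CSSCode.k_swap]; exact hR i) hp' hp1 hX

/-- **THE RATE–CODE-CAPACITY-THRESHOLD TRADEOFF FOR THE OPTIMAL DECODERS**: for a family of CSS codes with `k ≥ 1`
and rate `≥ R`, certified threshold lower bounds `a` (optimal `Z`-sector) and `b` (optimal `X`-sector) satisfy
`a + b ≤ (1 − R)/2`; hence the same for EVERY pair of decoder families (`z_optimal_isThresholdLowerBound_of`).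
[cite: BennettDivincenzoSmolin1997, p. 3218 (Q ≤ 1 − 2ε); DelfosseZemor2013, §3 (R ≤ 1 − 2p); RichardsonUrbanke2008, Lemma 4.78] -/
theorem optimal_thresholds_add_le_half_sub_rate (C : ∀ i, CSSCode (RX i) (RZ i) (Q i)) (hk : ∀ i, 0 < (C i).k)
    {R : ℝ} (hR : ∀ i, R * Fintype.card (Q i) ≤ (C i).k) {a b : ℝ}
    (ha : IsThresholdLowerBound (zOptimalFailureFamily C) a) (hb : IsThresholdLowerBound (xOptimalFailureFamily C) b) :
    a + b ≤ (1 - R) / 2 := by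
  by_contra h
  push Not at h
  have hab1 : a + b ≤ 1 / 2 := optimal_thresholds_add_le_half C hk ha hb
  have hR1 : R ≤ 1 := rate_le_one_opt C hk hR
  set c := ((1 - R) / 2 + (a + b)) / 2 with hc
  have hc0 : 0 ≤ c := by rw [hc]; linarith
  have hRc : (1 - R) / 2 < c := by rw [hc]; linarith
  have hcab : c < a + b := by rw [hc]; linarith
  have hc1 : c ≤ 1 / 2 := by linarith
  rcases le_or_gt a 0 with ha0 | ha0
  · have h2 := x_optimal_rate_le_half_sub_rate C hk hR hc0 hc1 (hb c hc0 (by linarith))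
    linarith
  rcases le_or_gt b 0 with hb0 | hb0
  · have h2 := z_optimal_rate_le_half_sub_rate C hk hR hc0 hc1 (ha c hc0 (by linarith))
    linarith
  obtain ⟨y, hy0, hyc, hya, hyb⟩ := exists_rate_between_opt hc0 ha0 hb0 hcab
  have h2 := optimal_rates_add_le_half_sub_rate C hk hR hy0 (by linarith : (0 : ℝ) ≤ c - y) (by linarith)
    (ha y hy0 hya) (hb (c - y) (by linarith) hyb)
  linarith

/-- **Accuracy-threshold form**: `p_c^{Z,opt} + p_c^{X,opt} ≤ (1 − R)/2` for every CSS family with `k ≥ 1` and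
rate `≥ R`. [cite: BennettDivincenzoSmolin1997, p. 3218 (Q ≤ 1 − 2ε); DennisEtAl2002, §4.6 (p_c)] -/
theorem optimal_accuracyThresholds_add_le_half_sub_rate (C : ∀ i, CSSCode (RX i) (RZ i) (Q i))
    (hk : ∀ i, 0 < (C i).k) {R : ℝ} (hR : ∀ i, R * Fintype.card (Q i) ≤ (C i).k) :
    accuracyThreshold (zOptimalFailureFamily C) + accuracyThreshold (xOptimalFailureFamily C) ≤ (1 - R) / 2 :=
  optimal_thresholds_add_le_half_sub_rate C hk hR (isThresholdLowerBound_accuracyThreshold _)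
    (isThresholdLowerBound_accuracyThreshold _)

/-- **One sector alone**: every certified optimal `Z`-threshold lower bound of a CSS family with `k ≥ 1` and rate
`≥ R` is `≤ (1 − R)/2`. [cite: BennettDivincenzoSmolin1997, p. 3218; DelfosseZemor2013, §3.3 (2|ℰ| ≤ rank H)] -/
theorem z_optimal_threshold_le_half_sub_rate (C : ∀ i, CSSCode (RX i) (RZ i) (Q i)) (hk : ∀ i, 0 < (C i).k)
    {R : ℝ} (hR : ∀ i, R * Fintype.card (Q i) ≤ (C i).k) {a : ℝ}
    (ha : IsThresholdLowerBound (zOptimalFailureFamily C) a) : a ≤ (1 - R) / 2 := by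
  have h := optimal_thresholds_add_le_half_sub_rate C hk hR ha
    (isThresholdLowerBound_of_nonpos (P := xOptimalFailureFamily C) le_rfl)
  linarith

/-- The `X`-sector alone: every certified optimal `X`-threshold lower bound is `≤ (1 − R)/2`.
[cite: BennettDivincenzoSmolin1997, p. 3218; DelfosseZemor2013, §3.3] -/
theorem x_optimal_threshold_le_half_sub_rate (C : ∀ i, CSSCode (RX i) (RZ i) (Q i)) (hk : ∀ i, 0 < (C i).k)
    {R : ℝ} (hR : ∀ i, R * Fintype.card (Q i) ≤ (C i).k) {b : ℝ}
    (hb : IsThresholdLowerBound (xOptimalFailureFamily C) b) : b ≤ (1 - R) / 2 := by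
  have h := optimal_thresholds_add_le_half_sub_rate C hk hR
    (isThresholdLowerBound_of_nonpos (P := zOptimalFailureFamily C) le_rfl) hb
  linarith

/-- `p_c^{Z,opt} ≤ (1 − R)/2` and `p_c^{X,opt} ≤ (1 − R)/2`. [cite: BennettDivincenzoSmolin1997, p. 3218; DennisEtAl2002, §4.6 (p_c)] -/
theorem optimal_accuracyThreshold_le_half_sub_rate (C : ∀ i, CSSCode (RX i) (RZ i) (Q i)) (hk : ∀ i, 0 < (C i).k)
    {R : ℝ} (hR : ∀ i, R * Fintype.card (Q i) ≤ (C i).k) :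
    accuracyThreshold (zOptimalFailureFamily C) ≤ (1 - R) / 2 ∧
      accuracyThreshold (xOptimalFailureFamily C) ≤ (1 - R) / 2 :=
  ⟨z_optimal_threshold_le_half_sub_rate C hk hR (isThresholdLowerBound_accuracyThreshold _),
    x_optimal_threshold_le_half_sub_rate C hk hR (isThresholdLowerBound_accuracyThreshold _)⟩

/-- **Sector-symmetric families, optimal decoding: `p₀^{opt} ≤ (1 − R)/4`** (the Bennett–DiVincenzo–Smolin value
`ε ≤ (1 − Q)/2` at flip rate `ε/2`). [cite: BennettDivincenzoSmolin1997, p. 3218 (Q = max{0, 1 − 2ε}); RichardsonUrbanke2008, Lemma 4.78] -/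
theorem optimal_threshold_le_quarter_sub_rate_of_symm (C : ∀ i, CSSCode (RX i) (RZ i) (Q i)) (hk : ∀ i, 0 < (C i).k)
    {R : ℝ} (hR : ∀ i, R * Fintype.card (Q i) ≤ (C i).k)
    (hsymm : xOptimalFailureFamily C = zOptimalFailureFamily C) {a : ℝ}
    (ha : IsThresholdLowerBound (zOptimalFailureFamily C) a) : a ≤ (1 - R) / 4 := by
  have h := optimal_thresholds_add_le_half_sub_rate C hk hR ha (hsymm ▸ ha)
  linarith

/-! ### Phenomenological noise (`q = p`): the optimal space-time families -/

/-- **Two below-threshold phenomenological rates cost `2p + 2p'` of rate — optimal space-time decoding.** For a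
family of CSS codes with `k ≥ 1`, rate `≥ R` and rounds `T_i, T'_i ≥ 1`: if the OPTIMAL phenomenological `Z`-family
is below threshold at `p` and the optimal `X`-family at `p'` (`p, p' ≥ 0`, `p + p' ≤ 1/2`), then
`p + p' ≤ (1 − R)/2`. [cite: BennettDivincenzoSmolin1997, p. 3218 (Q ≤ 1 − 2ε); DennisEtAl2002, §4.3 (optimal recovery) and §5.3 (p = q); BravyiSucharaVargo2014, §2] -/
theorem phenom_optimal_rates_add_le_half_sub_rate [∀ i, DecidableEq (RX i)] [∀ i, DecidableEq (RZ i)]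
    (C : ∀ i, CSSCode (RX i) (RZ i) (Q i)) (hk : ∀ i, 0 < (C i).k) {R : ℝ}
    (hR : ∀ i, R * Fintype.card (Q i) ≤ (C i).k) (T T' : ℕ → ℕ) (hT : ∀ i, 0 < T i) (hT' : ∀ i, 0 < T' i)
    {p p' : ℝ} (hp : 0 ≤ p) (hp' : 0 ≤ p') (hpp : p + p' ≤ 1 / 2)
    (hZ : BelowThreshold (zOptimalPhenomFailureFamily C T) p)
    (hX : BelowThreshold (xOptimalPhenomFailureFamily C T') p') : p + p' ≤ (1 - R) / 2 := by
  obtain ⟨DZ, hDZ⟩ := exists_zPhenomFailureFamily_eq_optimal C T p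
  obtain ⟨DX, hDX⟩ := exists_zPhenomFailureFamily_eq_optimal (fun i => (C i).swap) T' p'
  refine phenom_rates_add_le_half_sub_rate C hk hR T T' hT hT' DZ DX hp hp' hpp ?_ ?_
  · unfold BelowThreshold at hZ ⊢
    exact hZ.congr fun i => (hDZ i).symm
  · unfold BelowThreshold at hX ⊢
    rw [xOptimalPhenomFailureFamily_eq_swap] at hX
    exact hX.congr fun i => (hDX i).symm

/-- **One sector alone, optimal space-time decoding**: a below-threshold rate `0 ≤ p ≤ 1/2` of the optimal
phenomenological `Z`-family forces `p ≤ (1 − R)/2` (rounds `T_i ≥ 1`).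
[cite: BennettDivincenzoSmolin1997, p. 3218 (Q ≤ 1 − 2ε); DennisEtAl2002, §5.3] -/
theorem z_phenom_optimal_rate_le_half_sub_rate [∀ i, DecidableEq (RX i)] (C : ∀ i, CSSCode (RX i) (RZ i) (Q i))
    (hk : ∀ i, 0 < (C i).k) {R : ℝ} (hR : ∀ i, R * Fintype.card (Q i) ≤ (C i).k) (T : ℕ → ℕ) (hT : ∀ i, 0 < T i)
    {p : ℝ} (hp : 0 ≤ p) (hp1 : p ≤ 1 / 2) (hZ : BelowThreshold (zOptimalPhenomFailureFamily C T) p) :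
    p ≤ (1 - R) / 2 := by
  obtain ⟨DZ, hDZ⟩ := exists_zPhenomFailureFamily_eq_optimal C T p
  refine phenom_rate_le_half_sub_rate C hk hR T hT DZ hp hp1 ?_
  unfold BelowThreshold at hZ ⊢
  exact hZ.congr fun i => (hDZ i).symm

/-- The `X`-sector alone, optimal space-time decoding: `p' ≤ (1 − R)/2` (rounds `T'_i ≥ 1`).
[cite: BennettDivincenzoSmolin1997, p. 3218; DennisEtAl2002, §5.3] -/
theorem x_phenom_optimal_rate_le_half_sub_rate [∀ i, DecidableEq (RZ i)] (C : ∀ i, CSSCode (RX i) (RZ i) (Q i))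
    (hk : ∀ i, 0 < (C i).k) {R : ℝ} (hR : ∀ i, R * Fintype.card (Q i) ≤ (C i).k) (T' : ℕ → ℕ)
    (hT' : ∀ i, 0 < T' i) {p' : ℝ} (hp' : 0 ≤ p') (hp1 : p' ≤ 1 / 2)
    (hX : BelowThreshold (xOptimalPhenomFailureFamily C T') p') : p' ≤ (1 - R) / 2 := by
  rw [xOptimalPhenomFailureFamily_eq_swap] at hX
  exact z_phenom_optimal_rate_le_half_sub_rate (fun i => (C i).swap) (fun i => by rw [CSSCode.k_swap]; exact hk i)
    (fun i => by rw [CSSCode.k_swap]; exact hR i) T' hT' hp' hp1 hX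

/-- **THE RATE–PHENOMENOLOGICAL-THRESHOLD TRADEOFF FOR THE OPTIMAL SPACE-TIME DECODERS**: for a family of CSS codes
with `k ≥ 1`, rate `≥ R`, rounds `T_i, T'_i ≥ 1`, certified lower bounds `a` (optimal `Z`) and `b` (optimal `X`)
satisfy `a + b ≤ (1 − R)/2`; hence the same for EVERY pair of space-time decoder families
(`z_phenom_optimal_isThresholdLowerBound_of`). [cite: BennettDivincenzoSmolin1997, p. 3218 (Q ≤ 1 − 2ε); DennisEtAl2002, §4.6 and §5.3; RichardsonUrbanke2008, Lemma 4.78] -/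
theorem phenom_optimal_thresholds_add_le_half_sub_rate [∀ i, DecidableEq (RX i)] [∀ i, DecidableEq (RZ i)]
    (C : ∀ i, CSSCode (RX i) (RZ i) (Q i)) (hk : ∀ i, 0 < (C i).k) {R : ℝ}
    (hR : ∀ i, R * Fintype.card (Q i) ≤ (C i).k) (T T' : ℕ → ℕ) (hT : ∀ i, 0 < T i) (hT' : ∀ i, 0 < T' i)
    {a b : ℝ} (ha : IsThresholdLowerBound (zOptimalPhenomFailureFamily C T) a)
    (hb : IsThresholdLowerBound (xOptimalPhenomFailureFamily C T') b) : a + b ≤ (1 - R) / 2 := by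
  by_contra h
  push Not at h
  have hab1 : a + b ≤ 1 / 2 := phenom_optimal_thresholds_add_le_half C hk T T' hT hT' ha hb
  have hR1 : R ≤ 1 := rate_le_one_opt C hk hR
  set c := ((1 - R) / 2 + (a + b)) / 2 with hc
  have hc0 : 0 ≤ c := by rw [hc]; linarith
  have hRc : (1 - R) / 2 < c := by rw [hc]; linarith
  have hcab : c < a + b := by rw [hc]; linarith
  have hc1 : c ≤ 1 / 2 := by linarith
  rcases le_or_gt a 0 with ha0 | ha0
  · have h2 := x_phenom_optimal_rate_le_half_sub_rate C hk hR T' hT' hc0 hc1 (hb c hc0 (by linarith))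
    linarith
  rcases le_or_gt b 0 with hb0 | hb0
  · have h2 := z_phenom_optimal_rate_le_half_sub_rate C hk hR T hT hc0 hc1 (ha c hc0 (by linarith))
    linarith
  obtain ⟨y, hy0, hyc, hya, hyb⟩ := exists_rate_between_opt hc0 ha0 hb0 hcab
  have h2 := phenom_optimal_rates_add_le_half_sub_rate C hk hR T T' hT hT' hy0 (by linarith : (0 : ℝ) ≤ c - y)
    (by linarith) (ha y hy0 hya) (hb (c - y) (by linarith) hyb)
  linarith

/-- **Accuracy-threshold form**: `p_c^{ph,Z,opt} + p_c^{ph,X,opt} ≤ (1 − R)/2` (`k ≥ 1`, rate `≥ R`,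
`T_i, T'_i ≥ 1`). [cite: BennettDivincenzoSmolin1997, p. 3218 (Q ≤ 1 − 2ε); DennisEtAl2002, §4.6 (p_c) and §5.3] -/
theorem phenom_optimal_accuracyThresholds_add_le_half_sub_rate [∀ i, DecidableEq (RX i)] [∀ i, DecidableEq (RZ i)]
    (C : ∀ i, CSSCode (RX i) (RZ i) (Q i)) (hk : ∀ i, 0 < (C i).k) {R : ℝ}
    (hR : ∀ i, R * Fintype.card (Q i) ≤ (C i).k) (T T' : ℕ → ℕ) (hT : ∀ i, 0 < T i) (hT' : ∀ i, 0 < T' i) :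
    accuracyThreshold (zOptimalPhenomFailureFamily C T) + accuracyThreshold (xOptimalPhenomFailureFamily C T') ≤
      (1 - R) / 2 :=
  phenom_optimal_thresholds_add_le_half_sub_rate C hk hR T T' hT hT' (isThresholdLowerBound_accuracyThreshold _)
    (isThresholdLowerBound_accuracyThreshold _)

/-- **One sector alone**: every certified optimal phenomenological `Z`-threshold lower bound of a CSS family with
`k ≥ 1`, rate `≥ R` and rounds `T_i ≥ 1` is `≤ (1 − R)/2`; in particular `p_c^{ph,Z,opt} ≤ (1 − R)/2`.
[cite: BennettDivincenzoSmolin1997, p. 3218; DennisEtAl2002, §4.6 (p_c) and §5.3] -/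
theorem z_phenom_optimal_threshold_le_half_sub_rate [∀ i, DecidableEq (RX i)] (C : ∀ i, CSSCode (RX i) (RZ i) (Q i))
    (hk : ∀ i, 0 < (C i).k) {R : ℝ} (hR : ∀ i, R * Fintype.card (Q i) ≤ (C i).k) (T : ℕ → ℕ) (hT : ∀ i, 0 < T i)
    {a : ℝ} (ha : IsThresholdLowerBound (zOptimalPhenomFailureFamily C T) a) : a ≤ (1 - R) / 2 := by
  by_contra h
  push Not at h
  have ha1 : a ≤ 1 / 2 := z_phenom_optimal_threshold_le_half C hk T hT ha
  have hR1 : R ≤ 1 := rate_le_one_opt C hk hR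
  set c := ((1 - R) / 2 + a) / 2 with hc
  have hc0 : 0 ≤ c := by rw [hc]; linarith
  have hca : c < a := by rw [hc]; linarith
  have hc1 : c ≤ 1 / 2 := by linarith
  have h2 := z_phenom_optimal_rate_le_half_sub_rate C hk hR T hT hc0 hc1 (ha c hc0 hca)
  rw [hc] at h2
  linarith

/-- `p_c^{ph,Z,opt} ≤ (1 − R)/2`. [cite: BennettDivincenzoSmolin1997, p. 3218; DennisEtAl2002, §4.6 (p_c) and §5.3] -/
theorem z_phenom_optimal_accuracyThreshold_le_half_sub_rate [∀ i, DecidableEq (RX i)]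
    (C : ∀ i, CSSCode (RX i) (RZ i) (Q i)) (hk : ∀ i, 0 < (C i).k) {R : ℝ}
    (hR : ∀ i, R * Fintype.card (Q i) ≤ (C i).k) (T : ℕ → ℕ) (hT : ∀ i, 0 < T i) :
    accuracyThreshold (zOptimalPhenomFailureFamily C T) ≤ (1 - R) / 2 :=
  z_phenom_optimal_threshold_le_half_sub_rate C hk hR T hT (isThresholdLowerBound_accuracyThreshold _)

end CSSFamilies

end Summit.Ventures.QEC.Thresholds
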